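import Summits.BirchSwinnertonDyer.Rank1Residual.X2.NonsplitHalvesIntRigidity
import Summits.BirchSwinnertonDyer.Rank1Residual.X2.SplitHalvesOnTreeInt
import HarnessLib

/-!
# X2c (either sign of the reduction at `p ‖ N`): the BDP value half c2 in SIGN-FREE continuous-function
# currency — ONE attach point `BDPValueContinuousDisplayAt W p` for a `p`-adic Waldspurger formula printed
# in a foreign normalisation (road LZZ = Liu–Zhang–Zhang 2018 at `p = 3`; road HK), its POINTWISE contract,
# and the transfer to BOTH registered value atoms c2♭ / c2s♭ of crux 4 (cell `bsd-eis`, seat `bsd-eis-cgshw`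
# g14; route `EisensteinPrimes`, crux 4 `BSDpOnCellC` = stmt-BirchSwinnertonDyer-19034, line b1 v9
# f9bf0946, `stub_c2` (both conjuncts, `p = 3`); RULING L43 (2) «COMMISSION (O2)-LZZ@3», kernel side)

HONEST FRAMING (cell `bsd-eis`, run/shared/lean/pub/bsd-eis/): ONE hypothesis-shaped `@[conjecture]`
predicate (an attach point; nothing asserted) and four glue theorems; nothing booked; X2 stays
CONSTRUCTION-SHAPED; no label or count moves; BSD is not proved by any of this.

## Why

The registered value atom of crux 4 is `stub_c2` = c2♭ `NonsplitBDPValueOnTreeInt W 3` ∧ c2s♭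
`SplitBDPValueOnTreeInt W 3` (∀-frame shape: EVERY ♭-frame `Q` with Castella's interpolation property has
`Q(𝟙) = u·((1 − a_p p⁻¹)·log_{ω_E} P)²`, `‖u‖ = 1`). At `p ≥ 5` both conjuncts are discharged from print
([cas-split] Thms. 2.10–2.11 in BDP's display, `Castella2018Exceptional.thm210_thm211_bdpDisplay_pNew`, via
k5-c4's kernel rescaling `continuousDisplay_pNew_of_bdpDisplay` — a POINTWISE, SIGN-FREE statement in
continuous-function currency — and the X11b cell's one-sided value rigidity across periods). At `p = 3`
the value is not in print in Castella's currency; the two roads on file (LZZ18 Thm. 3.8 ∧ 3.10 ∧ Prop.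
4.12 with c2v MEMO-1/2's factor ledger `‖𝔠‖₃ = 1`; road HK, cgshw MEMO-13) are SIGN-FREE and deliver
their value with VIRTUAL periods, i.e. in continuous-function currency. The tree had that currency only
with the non-split binder (`NonsplitBDPValueContinuousDisplayAt`, k5-c4 `X2/NonsplitHalvesIntRigidity.lean`);
the split road at `p ≥ 5` inlined the rigidity step pointwise (`X2/SplitCellCClassIntPNew.lean`). This
file supplies the sign-free currency once, so that a kernel `lzz_rescale` (or any value theorem at `3 ‖ N`)
closes `stub_c2` BY NAME through ONE predicate:

* §1 **`BDPValueContinuousDisplayAt W p`** (c2-cont, sign-free): the body of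
  `NonsplitBDPValueContinuousDisplayAt W p` VERBATIM with the binder `¬ split` DELETED (the datum keeps
  `CellC W p`, so `p ‖ N` is odd, `E[p]` reducible, `r_an = 1`; either sign).
* §2 `nonsplitBDPValueContinuousDisplayAt_of_signFree` (drop the sign), **`splitBDPValueOnTreeInt_of_signFree`**
  (c2-cont ⟹ c2s♭: one-sided ♭-V1RIG, the split twin of k5-c4's `nonsplitBDPValueOnTreeInt_of_continuousDisplay`
  — the rigidity argument never used the sign), `nonsplitBDPValueOnTreeInt_of_signFree` (compose).
* §3 **`bdpValueContinuousDisplayAt_of_pointwise`** — the POINTWISE CONTRACT: a value theorem stated for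
  explicit data `(ι, K, 𝔭, κ, γ, Dt, H, ι_K, e, P, f)` under the hypotheses a printed source uses (`p ≠ 2`
  multiplicative for `W`, `p ∣ N`, `p² ∤ N`, `K` imaginary quadratic with `d_K < −4`, `p` split in `K`, `𝔭 ∋ p`
  singled out by `ι`, Heegner hypothesis for `N`, `κ` anticyclotomic with generator `γ`, `f` a newform of `W`,
  `p ∤ c(Dt)`, `P` the Heegner point read through `ι_K`, of infinite order, `e : K → ℚ_p` inducing `𝔭`) —
  exactly the shape of `continuousDisplay_pNew_of_bdpDisplay` WITHOUT `5 ≤ p` and WITHOUT `Odd d_K` —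
  implies `BDPValueContinuousDisplayAt W p`. This is the statement the (O2)-LZZ@3 typing (Literature fact in
  LZZ currency + kernel rescale with the c2v MEMO-2 factor ledger) has to reach; LZZ18 needs neither `p ≥ 5`
  nor `d_K` odd (only `𝔭` split in `K`, arXiv:1511.08172 p. 3 «We only need one assumption»).

What this is NOT: not a value theorem at `3 ‖ N` (the predicate is a hypothesis); not a Literature filing;
not a change of the registered skeleton (v9 stands; `stub_c2` is consumed verbatim by the companion
`Theorems/EisensteinPrimesBSDpOnCellCStubC2OfContinuousDisplay.lean`). CONDITIONAL on every displayed binder.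

References: [Castella2018Exceptional] Thms. 2.10–2.11 (arXiv:1507.04260 pp. 13–14); [Castella2018] Thms.
3.1–3.2 with (3.2) (arXiv:1704.06608 p. 9); [LiuZhangZhang2018] Thm. 3.8, Thm. 3.10, Prop. 4.12 (arXiv:1511.08172
pp. 3, 18, 23); [Hsieh2014] Thm. 1; c2v MEMO-1/2, cgshw MEMO-13/18 (HOME).
-/

set_option autoImplicit false

noncomputable section

open scoped Classical MatrixGroups ModularForm Topology

open Filter CongruenceSubgroup WeierstrassCurve NumberField IsDedekindDomain Field PowerSeries
  Literature.NumberTheory.EllipticCurves Literature.NumberTheory.EllipticCurves.GreenbergSelmer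
  Literature.NumberTheory.EllipticCurves.ModularForms
  Literature.NumberTheory.EllipticCurves.Rank1Residual
  Literature.NumberTheory.EllipticCurves.Rank1Residual.Typed
  Literature.NumberTheory.GaloisRepresentations Literature.NumberTheory.GaloisCohomology
  Literature.NumberTheory.Automorphic
  Summit.BirchSwinnertonDyer.Rank1Residual.X11b.AcSelmer
  Summit.BirchSwinnertonDyer.Rank1Residual.X11b.Halves
  Summit.BirchSwinnertonDyer.Rank1Residual.X11b

namespace Summit.BirchSwinnertonDyer.Rank1Residual.X2

/-! ### §1 The sign-free attach point -/

section Shape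

variable (W : WeierstrassCurve ℚ) [W.IsElliptic] [W.IsGloballyMinimal] (p : ℕ) [Fact p.Prime]

/-- **c2-cont, SIGN-FREE — the BDP value at `𝟙` in CONTINUOUS-FUNCTION CURRENCY at every X2c Heegner
datum (either sign of the reduction at `p`).** The body of `NonsplitBDPValueContinuousDisplayAt W p` VERBATIM
with the binder `¬ W.HasSplitMultiplicativeReductionAtPrime p` deleted: for every CGLS Heegner datum of a
rank-one X2 pair — level `N = N_E`, `K` imaginary quadratic with `d_K < −4`, the Heegner hypothesis for `N`,
`L(E^{d_K},1) ≠ 0`, parametrisation datum `Dt` with `p ∤ c`, Heegner point `P` of infinite order read through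
`ι_K`, anticyclotomic `(κ, γ)`, a degree-one `𝔭 ∋ p` —, every newform `f` of `E` and every embedding datum
`ι'` inducing `𝔭`, there are non-zero VIRTUAL PERIODS `(Ω_K, Ω_p)` and `u ∈ ℂ_p`, `‖u‖ = 1`, such that
Castella's display `ι'⁻¹(bdpInterpolationValue p f 𝔭 φ_k n_k Ω_K)·Ω_p^{4n_k}` tends to
`u·((1 − a_p(E)·p⁻¹)·log_{ω_E} P)²` along EVERY interpolation sequence `(φ_k, n_k, r_k)` through `κ` with
`r_k(γ) → 1`. PRINT STATUS: at `p ≥ 5` a THEOREM pointwise from [cas-split] Thms. 2.10–2.11 (k5-c4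
`continuousDisplay_pNew_of_bdpDisplay`, sign-free, for the admissible `K` with odd `d_K`); at `p = 3 ‖ N` NOT
in print in this currency — intended sources: Liu–Zhang–Zhang 2018 Thm. 3.8 ∧ Thm. 3.10 ∧ Prop. 4.12 (PUB;
sign-free; only hypothesis `𝔭` split in `K`) through a kernel rescale carrying c2v MEMO-2's factor ledger, or
road HK. A predicate on `(W, p)`; TYPED, not asserted; consumed as a hypothesis.
[cite: Castella2018Exceptional, Thm. 2.10 and Thm. 2.11 (arXiv:1507.04260 pp. 13–14) (shape of the p ≥ 5 source; nothing asserted)]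
[cite: Castella2018, Thm. 3.1 and Thm. 3.2 with (3.2) (arXiv:1704.06608 p. 9) (the display's normalisation)]
[cite: LiuZhangZhang2018, Thm. 3.8 and Thm. 3.10 (arXiv:1511.08172 p. 18) (intended p = 3 source; nothing asserted)] -/
@[conjecture]
def BDPValueContinuousDisplayAt : Prop :=
  ∀ (N : ℕ) [NeZero N] (K : Type) [Field K] [NumberField K] (Dt : ModularParametrizationData W N)
    (H : HeegnerDatum N (NumberField.discr K)) (ιK : K →+* ℂ) (P : (W.baseChange K).toAffine.Point),
    CellC W p → W.conductorNorm ℤ = N →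
    IsImaginaryQuadratic K → NumberField.discr K < -4 → SatisfiesHeegnerHypothesis N K →
    (W.quadraticTwist (NumberField.discr K : ℚ)).entireLFunction 1 ≠ 0 →
    WeierstrassCurve.Affine.Point.map ιK.toRatAlgHom P = heegnerPointComplex Dt H →
    ¬ (p : ℤ) ∣ Dt.c → ¬ IsOfFinAddOrder P →
    ∀ (κ : ZpExtension K p), κ.IsAnticyclotomic →
      ∀ (γ : Field.absoluteGaloisGroup K) [Fact (κ.IsTopGenerator γ)]
        (𝔭 : HeightOneSpectrum (𝓞 K)) (h𝔭 : ((p : ℕ) : 𝓞 K) ∈ 𝔭.asIdeal)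
        (he : 𝔭.asIdeal.ramificationIdx (𝓞 ℚ) = 1) (hf : 𝔭.asIdeal.inertiaDeg (𝓞 ℚ) = 1),
        ∀ (f : CuspForm (CongruenceSubgroup.Gamma0 N) 2), IsNewformOf W f →
          ∀ (ι' : PadicAlgCl p ≃+* ℂ),
            (∀ (w : InfinitePlace K) (k : 𝓞 K),
              k ∈ 𝔭.asIdeal ↔ ‖ι'.symm (w.embedding (k : K))‖ < 1) →
            ∃ (ΩK : ℂ) (Ωp u : ℂ_[p]), ΩK ≠ 0 ∧ Ωp ≠ 0 ∧ ‖u‖ = 1 ∧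
              ∀ (φ : ℕ → HeckeCharacter K) (n : ℕ → ℕ) (r : ℕ → FramedGaloisRep K (PadicAlgCl p) 1),
                (∀ k, 0 < n k) → (∀ k (v : HeightOneSpectrum (𝓞 K)), (φ k).IsUnramifiedAt v) →
                (∀ k, (φ k).HasInfinityType (fun _ ↦ (n k : ℤ)) (fun _ ↦ -(n k : ℤ))) →
                (∀ k, IsPAdicAvatarOf ι' (φ k) (r k)) → (∀ k, FactorsThroughZp κ (r k)) →
                Tendsto (fun k ↦ avatarValueAt (r k) γ) atTop (𝓝 1) →
                Tendsto (fun k ↦ ((ι'.symm (bdpInterpolationValue p f 𝔭 (φ k) (n k) ΩK) :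
                  PadicAlgCl p) : ℂ_[p]) * Ωp ^ (4 * n k)) atTop
                  (𝓝 (u * (algebraMap ℚ_[p] ℂ_[p] (((1 : ℚ_[p]) - ((W.LFunction p : ℤ) : ℚ_[p]) *
                    (p : ℚ_[p])⁻¹) * logOmega W p (embAt K p 𝔭 h𝔭 he hf) P)) ^ 2))

end Shape

/-! ### §2 Transfer to the registered value atoms (both signs) -/

section Transfer

variable {W : WeierstrassCurve ℚ} [W.IsElliptic] [W.IsGloballyMinimal] {p : ℕ} [Fact p.Prime]

/-- The sign-free continuous display gives the non-split one (the extra binder is discarded). [folklore] -/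
theorem nonsplitBDPValueContinuousDisplayAt_of_signFree (h : BDPValueContinuousDisplayAt W p) :
    NonsplitBDPValueContinuousDisplayAt W p := by
  intro N _ K _ _ Dt H ιK P hc _hns hN hK hd4 hHN hLt hP hcM hPinf κ hκ γ hγ 𝔭 h𝔭 he hf f hfW ι' hι'
  exact h N K Dt H ιK P hc hN hK hd4 hHN hLt hP hcM hPinf κ hκ γ 𝔭 h𝔭 he hf f hfW ι' hι'

/-- **c2-cont (sign-free) ⟹ c2s♭ `SplitBDPValueOnTreeInt W p`: a value theorem in continuous-function currency
transfers to EVERY ♭-frame at a SPLIT X2c datum.** The split twin of k5-c4's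
`nonsplitBDPValueOnTreeInt_of_continuousDisplay` (`X2/NonsplitHalvesIntRigidity.lean`), same proof — the
rigidity step never used the sign: the display's virtual periods `(Ω_K⁰, Ω_p⁰)` and unit `u` give convergence
to `c = u·((1 − a_p p⁻¹)·log_{ω_E} P)²` along every interpolation sequence with `r_k(γ) → 1`; `c ≠ 0`
(`a_p = ±1` at multiplicative `p`, `X11b.R1.not_dvd_lFunction_of_mult` — at a split `p`, `1 − p⁻¹ ≠ 0`;
`log_{ω_E} P ≠ 0`, `X11b.R1.logOmega_ne_zero`); so `[T⁰]Q = c` for every ♭-frame `Q` by one-sided ♭-V1RIG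
(`X11b.intSeries_constantCoeff_eq_of_isBDPLFunctionInt_of_continuousValues`, supply
`X11b.exists_interpolationSupply_pow` at odd `p`), and `Q(𝟙) = [T⁰]Q`. CONDITIONAL on c2-cont; nothing booked.
[cite: Castella2018Exceptional, Thm. 2.10 and Thm. 2.11 (arXiv:1507.04260 pp. 13–14)]
[cite: Castella2018, Thm. 3.1–3.2 (arXiv:1704.06608 p. 9)] [cite: SilvermanAEC2009, IV.6.4 and VII.6.3] -/
theorem splitBDPValueOnTreeInt_of_signFree (h : BDPValueContinuousDisplayAt W p) :
    SplitBDPValueOnTreeInt W p := by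
  intro N _ K _ _ Dt H ιK P hc _hs hN hK hd4 hHN hLt hP hcM hPinf κ hκ γ hγ 𝔭 h𝔭 he hf f hfW ι' hι'
    ΩK Ωp Q hΩK hΩp hQ
  obtain ⟨ΩK₀, Ωp₀, u, hΩK₀, hΩp₀, hu, hcont⟩ :=
    h N K Dt H ιK P hc hN hK hd4 hHN hLt hP hcM hPinf κ hκ γ 𝔭 h𝔭 he hf f hfW ι' hι'
  have hΩp0 : Ωp ≠ 0 := fun h0 ↦ by rw [h0, norm_zero] at hΩp; exact zero_ne_one hΩp
  -- `c ≠ 0`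
  have ha : ¬ (p : ℤ) ∣ W.LFunction p := X11b.R1.not_dvd_lFunction_of_mult hfW hc.2.2.2
  have hX : algebraMap ℚ_[p] ℂ_[p] (((1 : ℚ_[p]) - ((W.LFunction p : ℤ) : ℚ_[p]) * (p : ℚ_[p])⁻¹) *
      logOmega W p (embAt K p 𝔭 h𝔭 he hf) P) ≠ 0 :=
    algebraMap_one_sub_div_mul_ne_zero ha (X11b.R1.logOmega_ne_zero W p _ hPinf)
  have hu0 : u ≠ 0 := fun h0 ↦ by rw [h0, norm_zero] at hu; exact zero_ne_one hu
  have hc0 : u * (algebraMap ℚ_[p] ℂ_[p] (((1 : ℚ_[p]) - ((W.LFunction p : ℤ) : ℚ_[p]) *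
      (p : ℚ_[p])⁻¹) * logOmega W p (embAt K p 𝔭 h𝔭 he hf) P)) ^ 2 ≠ 0 :=
    mul_ne_zero hu0 (pow_ne_zero _ hX)
  have heq := X11b.intSeries_constantCoeff_eq_of_isBDPLFunctionInt_of_continuousValues hc.2.1 hK hκ
    hγ.out hΩK₀ hΩK hΩp₀ hΩp0 hcont hc0 hQ
  refine ⟨u, hu, ?_⟩
  rw [← heq]
  exact X11b.R1.intSeries_hasValueAt_zero p Q

/-- c2-cont (sign-free) ⟹ c2♭ `NonsplitBDPValueOnTreeInt W p` (drop the sign, then k5-c4's transfer).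
[cite: Castella2018Exceptional, Thm. 2.10 and Thm. 2.11 (arXiv:1507.04260 pp. 13–14)] -/
theorem nonsplitBDPValueOnTreeInt_of_signFree (h : BDPValueContinuousDisplayAt W p) :
    NonsplitBDPValueOnTreeInt W p :=
  nonsplitBDPValueOnTreeInt_of_continuousDisplay (nonsplitBDPValueContinuousDisplayAt_of_signFree h)

end Transfer

/-! ### §3 The pointwise contract (the shape a printed value theorem + kernel rescale delivers) -/

section Pointwise

variable {W : WeierstrassCurve ℚ} [W.IsElliptic] [W.IsGloballyMinimal] {p : ℕ} [Fact p.Prime]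

/-- **POINTWISE CONTRACT ⟹ c2-cont.** Suppose that for explicit data — an embedding datum `ι`, an imaginary
quadratic `K` with `d_K < −4`, a prime `𝔭 ∋ p` singled out by `ι`, an anticyclotomic `κ` with topological
generator `γ`, a parametrisation datum `Dt` of level `N = N_E` with `p ∤ c`, a Heegner datum `H`, an
embedding `ι_K : K → ℂ`, the Heegner point `P` (read through `ι_K`, of infinite order), any `e : K → ℚ_p`
inducing `𝔭`, and any newform `f` of `W` — under `p ≠ 2` multiplicative for `W`, `p ∣ N`, `p² ∤ N`, `p` split
in `K`, the Heegner hypothesis for `N` and `L(E^{d_K},1) ≠ 0`, there are virtual periods `Ω_K ≠ 0`, `Ω_p ≠ 0`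
and `‖u‖ = 1` with Castella's display for `f` tending to `u·((1 − a_p p⁻¹)·log_{ω_E} P)²` (logarithm along
`e`) along every interpolation sequence through `κ` with `r_k(γ) → 1`. This is the conclusion of k5-c4's
`continuousDisplay_pNew_of_bdpDisplay` with `Dt.f` generalised to any newform of `W`, `w.embedding` to any
`ι_K`, and WITHOUT `5 ≤ p` / `Odd d_K` — the statement a kernel rescale of Liu–Zhang–Zhang 2018 Thm. 3.8 ∧
3.10 ∧ Prop. 4.12 (only hypothesis: `𝔭` split) is to reach at `p = 3`. THEN `BDPValueContinuousDisplayAt W p`: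
the predicate's binders supply every hypothesis (`p ≠ 2` and multiplicativity from `CellC`; `p ∣ N`, `p² ∤ N`
from multiplicativity, `X11b.dvd_conductorNorm_of_mult` / `X11b.not_sq_dvd_conductorNorm_of_mult`; `p` split
from the Heegner hypothesis at `p ∣ N`; `e := embAt K p 𝔭`, `mem_asIdeal_iff_norm_embAt_lt_one`), and
`logOmega = padicLogOmega` definitionally. [folklore]
[cite: LiuZhangZhang2018, Thm. 3.8 and Thm. 3.10 (arXiv:1511.08172 p. 18) (intended source of the hypothesis at p = 3; nothing asserted)] -/
theorem bdpValueContinuousDisplayAt_of_pointwise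
    (hpt : ∀ (ι : PadicAlgCl p ≃+* ℂ) (K : Type) [Field K] [NumberField K]
      (𝔭 : HeightOneSpectrum (𝓞 K)) (κ : ZpExtension K p) (γ : absoluteGaloisGroup K) {N : ℕ} [NeZero N]
      (Dt : ModularParametrizationData W N) (H : HeegnerDatum N (NumberField.discr K))
      (ιK : K →+* ℂ) (e : K →+* ℚ_[p]) (P : (W.baseChange K).toAffine.Point)
      (f : CuspForm (CongruenceSubgroup.Gamma0 N) 2),
      p ≠ 2 → W.HasMultiplicativeReductionAtPrime p → W.conductorNorm ℤ = N → p ∣ N → ¬ p ^ 2 ∣ N →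
      IsImaginaryQuadratic K → NumberField.discr K < -4 →
      ((Ideal.span {(p : ℤ)}).primesOver (𝓞 K)).ncard = 2 →
      ((p : ℕ) : 𝓞 K) ∈ 𝔭.asIdeal →
      (∀ (w' : InfinitePlace K) (k : 𝓞 K), k ∈ 𝔭.asIdeal ↔ ‖ι.symm (w'.embedding (k : K))‖ < 1) →
      SatisfiesHeegnerHypothesis N K →
      (W.quadraticTwist (NumberField.discr K : ℚ)).entireLFunction 1 ≠ 0 →
      κ.IsAnticyclotomic → κ.IsTopGenerator γ →
      IsNewformOf W f → ¬ (p : ℤ) ∣ Dt.c →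
      WeierstrassCurve.Affine.Point.map ιK.toRatAlgHom P = heegnerPointComplex Dt H →
      ¬ IsOfFinAddOrder P →
      (∀ k : 𝓞 K, k ∈ 𝔭.asIdeal ↔ ‖e (k : K)‖ < 1) →
      ∃ (ΩK : ℂ) (Ωp u : ℂ_[p]), ΩK ≠ 0 ∧ Ωp ≠ 0 ∧ ‖u‖ = 1 ∧
        ∀ (φ : ℕ → HeckeCharacter K) (n : ℕ → ℕ) (r : ℕ → FramedGaloisRep K (PadicAlgCl p) 1),
          (∀ k, 0 < n k) → (∀ k (v : HeightOneSpectrum (𝓞 K)), (φ k).IsUnramifiedAt v) →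
          (∀ k, (φ k).HasInfinityType (fun _ ↦ (n k : ℤ)) (fun _ ↦ -(n k : ℤ))) →
          (∀ k, IsPAdicAvatarOf ι (φ k) (r k)) → (∀ k, FactorsThroughZp κ (r k)) →
          Tendsto (fun k ↦ avatarValueAt (r k) γ) atTop (𝓝 1) →
          Tendsto (fun k ↦ ((ι.symm (bdpInterpolationValue p f 𝔭 (φ k) (n k) ΩK) :
            PadicAlgCl p) : ℂ_[p]) * Ωp ^ (4 * n k)) atTop
            (𝓝 (u * (algebraMap ℚ_[p] ℂ_[p] (((1 : ℚ_[p]) - ((W.LFunction p : ℤ) : ℚ_[p]) *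
              (p : ℚ_[p])⁻¹) * Castella2018.padicLogOmega W p e P)) ^ 2))) :
    BDPValueContinuousDisplayAt W p := by
  intro N _ K _ _ Dt H ιK P hc hN hK hd4 hHN hLt hP hcM hPinf κ hκ γ hγ 𝔭 h𝔭 he hf f hfW ι' hι'
  have hp : p.Prime := Fact.out
  obtain ⟨_, hp2, _, hmult⟩ := hc
  have hpN' : p ∣ W.conductorNorm ℤ := X11b.dvd_conductorNorm_of_mult (W := W) hmult
  have hpN : p ∣ N := by rwa [hN] at hpN'
  have hp2N : ¬ p ^ 2 ∣ N := by
    have h := X11b.not_sq_dvd_conductorNorm_of_mult (W := W) (p := p) hmult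
    rwa [hN] at h
  have hemb : ∀ k : 𝓞 K, k ∈ 𝔭.asIdeal ↔ ‖embAt K p 𝔭 h𝔭 he hf (k : K)‖ < 1 :=
    mem_asIdeal_iff_norm_embAt_lt_one 𝔭 h𝔭 he hf
  obtain ⟨ΩK, Ωp, u, hΩK, hΩp, hu, hcont⟩ := hpt ι' K 𝔭 κ γ Dt H ιK (embAt K p 𝔭 h𝔭 he hf) P f hp2
    hmult hN hpN hp2N hK hd4 (hHN p hp hpN) h𝔭 hι' hHN hLt hκ hγ.out hfW hcM hP hPinf hemb
  exact ⟨ΩK, Ωp, u, hΩK, hΩp, hu, hcont⟩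

end Pointwise

end Summit.BirchSwinnertonDyer.Rank1Residual.X2

end
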